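import Summits.AtomisticToContinuum.FouriersLaw.Theorems.BondHeatUncertaintyExtensiveSnapshotIrreversibilityEnergyWindowDepartureGlueB

/-!
# Energy window, part W-6 — the DEPARTURE GLUE — file 3 of 3 (sequel of `…BondHeatUncertaintyExtensiveSnapshotIrreversibilityEnergyWindowDepartureGlueB`)

Split for the 400-line cap; the module docstring of file 1 describes the whole part.
This file holds §6 (the departure glue) and §7 (junctions).
Same namespace, same section variables; no instance / notation / option; no proof holes.
[folklore]
-/

noncomputable section

namespace Summit.AtomisticToContinuum.FouriersLaw.Theorems.ExtensiveSnapshotIrreversibility.EnergyWindow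

open MeasureTheory ProbabilityTheory Filter Topology Set
open scoped ENNReal NNReal Matrix ContDiff
open Literature.MathematicalPhysics.KineticTheory.HeatConduction
open Literature.Probability.Process
open Literature.Probability.Distributions

section Departure

variable {ω₂ lam β γ : ℝ} (hω : 0 < ω₂) (hl : 0 < lam) (hβ : 0 < β) (hγ : 0 < γ) {N : ℕ}
  (hN : 0 < N) {T T_L T_R : ℝ} (hT : 0 < T) (hTL : T / 2 ≤ T_L) (hTL' : T_L ≤ 2 * T)
  (hTR : T / 2 ≤ T_R) (hTR' : T_R ≤ 2 * T)

/-! ## 6. The glue -/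

omit hN hTL hTL' hTR hTR' in
include hω hl hβ hγ hT in
/-- ★★ **DEPARTURE GLUE** — (SWM)_d → (JM)✓ → (JMˣ)₁✓ → (JMˣ)₂✓ → (I-s2)ₛ → (G1ℓ)
`EqualTemperatureBathLipschitz` for the chain with parameters `ω₂, lam, β, γ, T` ((JM)/(JMˣ)₁/(JMˣ)₂
enter as the theorems `skeletonStartVariationMoments` / `skeletonJacobianMoments` /
`skeletonSecondVariationMoments`; no (SWM)-type claim is made — it is the hypothesis `hW`).
[cite: CuneoEckmannHairerReyBellet2018, §3 eq. (3.4)] -/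
theorem equalTemperatureBathLipschitz_at (hW : SkeletonWeightMoments)
    (hI : SkeletonEventualSurjectivity) (hN2 : 2 ≤ N) {θ θ₁ : ℝ} (hθ : 0 < θ) (hθθ₁ : θ < θ₁)
    (hθ₁ : θ₁ < 1 / T) :
    ∃ a C : ℝ, a < 1 ∧ ∀ r : ℝ, 0 < r → r ≤ 1 →
      ∀ (h : PhaseSpace N → ℝ), ContDiff ℝ ∞ h → HasCompactSupport h →
        (∀ y, |h y| ≤ Real.exp (θ * (pinnedChain ω₂ lam β γ).hamiltonian N y)) →
        ∀ b : Fin N, (b = leftBath N hN2 ∨ b = rightBath N hN2) →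
          ∀ (w : PhaseSpace N) (t : ℝ),
            |eqKernelFun ω₂ lam β γ T N h r (w.1, Function.update w.2 b t) -
                eqKernelFun ω₂ lam β γ T N h r w| ≤
              C * r ^ (-a) * |t - w.2 b| *
                max (Real.exp (θ₁ * (pinnedChain ω₂ lam β γ).hamiltonian N w))
                  (Real.exp (θ₁ * (pinnedChain ω₂ lam β γ).hamiltonian N
                    (w.1, Function.update w.2 b t))) := by
  have hN0 : 0 < N := by omega
  have hθT : θ * T < 1 := by
    have h1 : θ < 1 / T := hθθ₁.trans hθ₁
    rwa [lt_div_iff₀ hT] at h1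
  have hθT0 : 0 < θ * T := mul_pos hθ hT
  -- Hölder exponents `p = 1/a`, `q = 1/(1-a)`, `a = (1 + θT)/2`
  have ha0 : 0 < (1 + θ * T) / 2 := by linarith
  have ha1 : (1 + θ * T) / 2 < 1 := by linarith
  have hpq := Real.HolderConjugate.inv_one_sub_inv ha0 ha1
  have hp : 0 < ((1 + θ * T) / 2)⁻¹ := hpq.pos
  have hq2 : 2 ≤ (1 - (1 + θ * T) / 2)⁻¹ := by
    rw [le_inv_comm₀ two_pos (by linarith)]
    linarith
  have hpθ : ((1 + θ * T) / 2)⁻¹ * θ < 1 / max T T := by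
    rw [max_self, lt_div_iff₀ hT, mul_assoc, inv_mul_lt_iff₀ ha0]
    linarith
  have hε : 0 < θ₁ - θ := sub_pos.2 hθθ₁
  obtain ⟨C, b₀, δ₀, hb₀, -, -, hDep⟩ := hW ω₂ lam β γ hω hl hβ hγ T hT N hN2 _ (θ₁ - θ) hq2 hε
  refine ⟨b₀, Real.exp (((1 + θ * T) / 2)⁻¹ * θ * γ * (T + T)) ^ (((1 + θ * T) / 2)⁻¹)⁻¹ * |C|,
    hb₀, fun r hr0 hr1 h hh hhc hhθ b hb w t => ?_⟩
  have hz₁ := prod_update_eq_add_smul w b t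
  rw [hz₁]
  set v₀ : PhaseSpace N := ((0 : Fin N → ℝ), Pi.single b 1) with hv₀
  set c : ℝ := t - w.2 b with hc
  have hr : r ∈ Icc (0 : ℝ) 1 := ⟨hr0.le, hr1⟩
  have hh1 : ContDiff ℝ 1 h := hh.of_le (by exact_mod_cast le_top)
  -- bounds on `h` and `Dh`
  obtain ⟨M₀, hM₀⟩ := hh.continuous.bounded_above_of_compact_support hhc
  have hgM : ∀ y, |h y| ≤ M₀ := fun y => by rw [← Real.norm_eq_abs]; exact hM₀ y
  obtain ⟨L₀, hL₀⟩ := (hh1.continuous_fderiv one_ne_zero).bounded_above_of_compact_support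
    (hhc.fderiv (𝕜 := ℝ))
  have hgL : ∀ y v, |fderiv ℝ h y v| ≤ max L₀ 0 * ‖v‖ := fun y v => by
    rw [← Real.norm_eq_abs]
    exact (fderiv ℝ h y).le_of_opNorm_le ((hL₀ y).trans (le_max_left _ _)) v
  have hgM' : ∀ y, |h y| ≤ 1 * Real.exp (θ * (pinnedChain ω₂ lam β γ).hamiltonian N y) :=
    fun y => by rw [one_mul]; exact hhθ y
  -- the kernel as a path integral (level `0`), the Fubini–FTC identity
  rw [eqKernelFun_eq_integral_skelFlowMapAt hω hl.le hβ.le hγ.le N T hr 0 hh.continuous.measurable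
      (w + c • v₀),
    eqKernelFun_eq_integral_skelFlowMapAt hω hl.le hβ.le hγ.le N T hr 0 hh.continuous.measurable w,
    integral_comp_sub_eq_mul_integral_partialP hω hl hβ hγ hN0 hT (T_L := T) (T_R := T)
      (by linarith) (by linarith) (by linarith) (by linarith) hr 0 b w c hh1 hgM hgL]
  -- the per-point departure bound on the segment
  have hsurj : ∀ (z : PhaseSpace N) (wp : WienerPair), ∃ m₀ : ℕ, ∀ m, m₀ ≤ m → LinearMap.range
      (fderiv ℝ (skelFlowMapAt ω₂ lam β γ N T T r m z (pairRem m wp)) (pairSkel m wp) :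
        PairSkeleton m →ₗ[ℝ] PhaseSpace N) = ⊤ := fun z wp =>
    hI ω₂ lam β γ hω hl hβ hγ N hN0 _ _ hT hT r hr0 hr1 z wp
  have hG : ∀ z : PhaseSpace N, |∫ wp, partialP b (fun z' => h (skelFlowMapAt ω₂ lam β γ N T T r 0
      z' (pairRem 0 wp) (pairSkel 0 wp))) z ∂wienerPair| ≤
      Real.exp (((1 + θ * T) / 2)⁻¹ * θ * γ * (T + T)) ^ (((1 + θ * T) / 2)⁻¹)⁻¹ * |C| *
        r ^ (-b₀) * Real.exp (θ₁ * (pinnedChain ω₂ lam β γ).hamiltonian N z) := by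
    intro z
    have h1 := fun m : ℕ => lintegral_rpow_abs_comp_skelFlowMapAt_le hω hl hβ hγ hN0 (T_L := T)
      (T_R := T) hT hT hθ hp hpθ hr m z zero_le_one hgM'
    have h2 : ∀ κ : ℝ, 0 < κ → ∃ m₁ : ℕ, ∀ m : ℕ, m₁ ≤ m →
        skelMoment m (1 - (1 + θ * T) / 2)⁻¹ (skelWeightDep ω₂ lam β γ N T T r m κ b z) ≤
          ENNReal.ofReal ((|C| * (r ^ (-b₀) *
            Real.exp ((θ₁ - θ) * (pinnedChain ω₂ lam β γ).hamiltonian N z))) ^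
              (1 - (1 + θ * T) / 2)⁻¹) := by
      intro κ hκ
      obtain ⟨m₁, hm₁⟩ := hDep r hr0 hr1 b hb z κ hκ
      refine ⟨m₁, fun m hm => (hm₁ m hm).trans ?_⟩
      rw [mul_assoc]
      exact ofReal_rpow_le_ofReal_abs_rpow C _
        (mul_pos (Real.rpow_pos_of_pos hr0 _) (Real.exp_pos _)) _
    have hA₁ : 0 ≤ 1 * Real.exp (((1 + θ * T) / 2)⁻¹ * θ * γ * (T + T)) ^
        (((1 + θ * T) / 2)⁻¹)⁻¹ * Real.exp (θ * (pinnedChain ω₂ lam β γ).hamiltonian N z) :=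
      mul_nonneg (mul_nonneg zero_le_one (Real.rpow_nonneg (Real.exp_pos _).le _))
        (Real.exp_pos _).le
    have hA₂ : 0 ≤ |C| * (r ^ (-b₀) *
        Real.exp ((θ₁ - θ) * (pinnedChain ω₂ lam β γ).hamiltonian N z)) :=
      mul_nonneg (abs_nonneg _) (mul_pos (Real.rpow_pos_of_pos hr0 _) (Real.exp_pos _)).le
    have hmain := abs_integral_partialP_dep_le hω hl hβ hγ hN0 hT (T_L := T) (T_R := T)
      (by linarith) (by linarith) (by linarith) (by linarith) hpq hr b z (hsurj z) hh1 hhc hA₁ hA₂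
      h1 h2 0
    refine hmain.trans (le_of_eq ?_)
    have hexp : Real.exp (θ * (pinnedChain ω₂ lam β γ).hamiltonian N z) *
        Real.exp ((θ₁ - θ) * (pinnedChain ω₂ lam β γ).hamiltonian N z) =
        Real.exp (θ₁ * (pinnedChain ω₂ lam β γ).hamiltonian N z) := by
      rw [← Real.exp_add]
      congr 1
      ring
    rw [← hexp]
    ring
  -- the bound on the segment and the conclusion
  set K₀ : ℝ := Real.exp (((1 + θ * T) / 2)⁻¹ * θ * γ * (T + T)) ^ (((1 + θ * T) / 2)⁻¹)⁻¹ * |C|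
    with hK₀
  have hK₀0 : 0 ≤ K₀ := mul_nonneg (Real.rpow_nonneg (Real.exp_pos _).le _) (abs_nonneg _)
  have hseg : ∀ τ ∈ uIoc (0 : ℝ) 1, ‖∫ wp, partialP b (fun z' => h (skelFlowMapAt ω₂ lam β γ N T T r 0
      z' (pairRem 0 wp) (pairSkel 0 wp))) (w + (τ * c) • v₀) ∂wienerPair‖ ≤
      K₀ * r ^ (-b₀) * max (Real.exp (θ₁ * (pinnedChain ω₂ lam β γ).hamiltonian N w))
        (Real.exp (θ₁ * (pinnedChain ω₂ lam β γ).hamiltonian N (w + c • v₀))) := by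
    intro τ hτ
    rw [uIoc_of_le zero_le_one] at hτ
    have hτ' : τ ∈ Icc (0 : ℝ) 1 := ⟨hτ.1.le, hτ.2⟩
    rw [Real.norm_eq_abs]
    refine (hG _).trans (mul_le_mul_of_nonneg_left ?_ (mul_nonneg hK₀0 (Real.rpow_pos_of_pos hr0 _).le))
    have hH := hamiltonian_segment_le_max (pinnedChain ω₂ lam β γ) w b c hτ'
    rcases le_max_iff.1 hH with h1 | h1
    · exact le_max_of_le_left (Real.exp_le_exp.2 (mul_le_mul_of_nonneg_left h1 (hθ.trans hθθ₁).le))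
    · exact le_max_of_le_right (Real.exp_le_exp.2 (mul_le_mul_of_nonneg_left h1 (hθ.trans hθθ₁).le))
  have hI1 := intervalIntegral.norm_integral_le_of_norm_le_const hseg
  rw [sub_zero, abs_one, mul_one] at hI1
  rw [abs_mul]
  calc |c| * |∫ τ in (0 : ℝ)..1, ∫ wp, partialP b (fun z' => h (skelFlowMapAt ω₂ lam β γ N T T r 0
        z' (pairRem 0 wp) (pairSkel 0 wp))) (w + (τ * c) • v₀) ∂wienerPair|
      ≤ |c| * (K₀ * r ^ (-b₀) * max (Real.exp (θ₁ * (pinnedChain ω₂ lam β γ).hamiltonian N w))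
          (Real.exp (θ₁ * (pinnedChain ω₂ lam β γ).hamiltonian N (w + c • v₀)))) := by
        rw [← Real.norm_eq_abs (∫ τ in (0 : ℝ)..1, _)]
        exact mul_le_mul_of_nonneg_left hI1 (abs_nonneg c)
    _ = _ := by ring

end Departure

/-- ★★★ **DEPARTURE GLUE, route form**: (SWM) → (I-s2)ₛ → (G1ℓ) ((JM), (JMˣ)₁, (JMˣ)₂ discharged by
the theorems `skeletonStartVariationMoments`, `skeletonJacobianMoments`,
`skeletonSecondVariationMoments`). [folklore] -/
theorem equalTemperatureBathLipschitz_of_skeleton (hW : SkeletonWeightMoments)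
    (hI : SkeletonEventualSurjectivity) : EqualTemperatureBathLipschitz :=
  fun _ω₂ _lam _β _γ hω hl hβ hγ _T hT _N hN _θ _θ₁ hθ hθθ₁ hθ₁ =>
    equalTemperatureBathLipschitz_at hω hl hβ hγ hT hW hI hN hθ hθθ₁ hθ₁

/-! ## 7. Junctions: both glues with (JMˣ)₂ discharged; S3 and K_fix from (Dˢ), (SWM), (I-s2)ₛ -/

/-- ★★★ **ARRIVAL GLUE with (JMˣ)₂ discharged** (W-3 `perturbedKernelMomentumIBPCompact_of_skeleton`
fed with the tree theorem V-c `skeletonSecondVariationMoments`): (SWM) → (I-s2)ₛ → (G1*ᶜᶜ).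
[folklore] -/
theorem perturbedKernelMomentumIBPCompact_of_skeleton₂ (hW : SkeletonWeightMoments)
    (hI : SkeletonEventualSurjectivity) : PerturbedKernelMomentumIBPCompact :=
  perturbedKernelMomentumIBPCompact_of_skeleton hW skeletonSecondVariationMoments hI

/-- ★★★★ **S3 from the skeleton**: (Dˢ) → (SWM) → (I-s2)ₛ → `KernelTemperatureLipschitz`
(Rᵇ `kernelTemperatureLipschitz_of_testClasses` with the two glues). [folklore] -/
theorem kernelTemperatureLipschitz_of_skeleton (hD : KernelTemperatureDuhamelSmooth)
    (hW : SkeletonWeightMoments) (hI : SkeletonEventualSurjectivity) :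
    KernelTemperatureLipschitz :=
  kernelTemperatureLipschitz_of_testClasses hD (equalTemperatureBathLipschitz_of_skeleton hW hI)
    (perturbedKernelMomentumIBPCompact_of_skeleton₂ hW hI)

/-- ★ **The junction `K_fix ⟸ A0 ∧ A2 ∧ (Dˢ) ∧ (SWM) ∧ (I-s2)ₛ ∧ A3p ∧ A4`** (Rᵇ
`snapshotKLUpperExpansion_of_atoms₇R` with the two glues). [folklore] -/
theorem snapshotKLUpperExpansion_of_atoms₇W (h0 : NessGibbsReweighting)
    (h2 : NessOddLogRatioBound) (hD : KernelTemperatureDuhamelSmooth)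
    (hW : SkeletonWeightMoments) (hI : SkeletonEventualSurjectivity) (h3p : NessFloorMeanValue)
    (h4 : NessLinearResponseL2) : SnapshotKLUpperExpansion :=
  snapshotKLUpperExpansion_of_atoms₇R h0 h2 hD (equalTemperatureBathLipschitz_of_skeleton hW hI)
    (perturbedKernelMomentumIBPCompact_of_skeleton₂ hW hI) h3p h4

end Summit.AtomisticToContinuum.FouriersLaw.Theorems.ExtensiveSnapshotIrreversibility.EnergyWindow

end
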